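import Summits.QuantumFields.BalabanUV.Beta.FP.ShotBridge
import Summits.QuantumFields.BalabanUV.Beta.FP.SymmetryInheritGeneric

/-!
# `BalabanUV.Beta.FP.RoadEndShot` — road «FP» for binder row D1: THE ROAD's GENERIC ENDs WITH THE (ASYMP) BINDER `hasym` SUPPLIED BY THE
# CROSS-ROAD BRIDGE (owner ruling R-FP-14, `FP/ShotBridge` §1) — residual `hasym` ↦ {road BF-x's level-0 law `hTlaw`, the two-stage telescoping
# identity `htel2` with bounded defect `hδ2`, X1m `hlimX1m`}; plus the scalar form and the junction of the bridge's T-side with the rate certificate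
# (β sub-cell; lane beta-asym1 = unit `b2b-balaban-beta-asym1`, gen 49; claim table `HOME/b2b-balaban-beta-d1-p3/LEAVES-FP.md` row BRIDGE-INSTANCE as
# RE-SCOPED by the road owner, journal l.17756 (f): «file asym1's J4 composition as a tree module `FP/RoadEndShot.lean`»)

NOT IN PRINT; OUR BOOKKEEPING.  HONEST FRAMING (cell charter, verbatim): «discharging `BetaPertH` makes Bałaban's UV stability UNCONDITIONAL — a real
constructive-QFT result; it is NOT the continuum limit and NOT the Clay problem.»  THIS MODULE DISCHARGES NOTHING: it COMPOSES tree theorems.  The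
`hasym` binder (N7 ∕ (ASYMP): `∀ m ≥ 1, |fPerfG … m − m·stepBal N Lc| ≤ Cg`) of road FP's three dressing-agnostic ENDs of record —
`RoadEndGeneric.d1Drift_of_generic_step_law_bounded` (p224132), `StepLawWardGeneric.d1Drift_of_generic_ward_symm_explicitDefect` (p224345),
`SymmetryInheritGeneric.d1Drift_of_generic_wardRow_swapRow_explicitDefect` (p226775) — is, BY TYPE, the conclusion of the owner's bridge
`ShotBridge.hasym_of_shot_twoStage` (p226410) at `fP := fPerfG Lc sf sm A G S Wt μ ν`, `s := stepBal N Lc`, `Cg := 2·C₀ + D`.  So each END reads with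
`hasym` REPLACED by the bridge's four inputs: road BF-x's level-0 one-shot law in bounded form `hTlaw : ∀ k, |F₀ (Lc^k) − k·stepBal N Lc| ≤ C₀`, the
two-stage telescoping identity `htel2 : F₀ (Lc^(j+m)) = F₀ (Lc^j) + f j m + δ j m`, its defect bound `hδ2 : |δ j m| ≤ D`, and the X1m convergence
`hlimX1m : f j m → fPerfG … m` — ALL FOUR HYPOTHESES, displayed, none discharged (T is road BF-x's, the defect algebra an4's ∕ N7's, X1m row G-an2-4's).
READING (header only, never a hypothesis): `F₀ (Lc^k)` = BF-x's `shotCoeff` at blocking `Lc^k`; `f j m` = the (1.22) coefficient of the finite-level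
(j, m) family; see `FP/ShotBridge`'s header.
CONTENT.
* §1 scalar level — **`value_eq_of_shot_twoStage_step_law`**: T + two-stage defects + X1m + the step law `g (m+1) = g m + g 1` ⟹ `g 1 = s`
  (`RoadEnd.value_eq_of_step_law_bounded'` with `hasym := hasym_of_shot_twoStage …`).
* §2 kernel level — **`d1Drift_of_generic_step_law_shot`** (the generic END, (STEP) `hstep` displayed), **`d1Drift_of_generic_ward_symm_explicitDefect_shot`**
  (the Ward END: `hWf`, `hTsymm`, `hSDF` displayed), **`d1Drift_of_generic_wardRow_swapRow_shot`** (the END fed by the wall's symmetry ROWS `hWj`, `hTj`):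
  each is the END of record applied to `hasym_of_shot_twoStage hTlaw htel2 hδ2 hlimX1m`, every other binder copied verbatim from the tree END.
* §3 the bridge's T-SIDE meets the rate certificate (`Literature…Beta.RateCertificate`, `…Beta.Drift`) — **`oneLoopDrift_of_shot_oneStage`** (T + ONE-stage
  telescoping `F₀ (L^k) = Σ_{j<k} β j + ε k` with `|ε k| ≤ E` ⟹ `OneLoopDrift s (C+E) β`), **`lim_eq_of_shot_cauchyRate`** (+ X1 in Cauchy currency
  `CauchyRate β c θ`, `θ < 1`, NO value named ⟹ `CauchyRate.lim β = s`), **`geomRate_of_shot_cauchyRate`** (⟹ `GeomRate β s (c/(1−θ)) θ`),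
  **`laneClause_of_shot_cauchyRate`** (at `s := stepBal N Lc`: `∀ k, |β k − stepBal N Lc| ≤ (c/(1−θ))·θ^k` ∧ the limit identified),
  **`pos_all_of_shot_cauchyRate_cert`** (+ certified small-`k` signs and ONE certified value ⟹ `∀ k, 0 < β k`, `GeomRate.pos_all`),
  **`lim_pos_of_shot_cauchyRate`** (`0 < CauchyRate.lim β` from `0 < N`, `1 < Lc`, no certificate).
NOT HERE: T itself (road BF-x), the two-stage ∕ one-stage identities and defect bounds at the families of record (an4 ∕ N7 ∕ (SDF) lane), X1 ∕ X1m and every row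
(G-an2-4 and the stencil ∕ table rows), `hWf`∕`hWj`, `hTsymm`∕`hTj`, `hSDF`, (STEP).  NOT «D1 closed», NOT (ASYMP) proved, NOT BetaPertH, NOT continuum, NOT Clay.
ABSOLUTE RULE (cell charter, verbatim): «No internally-minted statement may enter as a cited fact. Every hypothesis is either kernel-proved in this
package or a verbatim quotation of a PUBLISHED theorem with page reference.»  Nothing cited; 0 `def`; no binder instantiated at a value.
HONEST DEPENDENCY (verbatim): «continuum YM on T⁴ ⇐ BetaPertH ∧ nine spine estimates (0/9 proved); BetaPertH ⇐ (D1) ∧ (D4) ∧ CAP+tail;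
G-an2-4 gates asym, D1 and NE2/3/4.»
Provenance: lane beta-asym1 (planner seat, gen 49), 2026-08-20 — asym1's junction note on R-FP-14 (journal l.17734, probe `XreadShotBridge.lean`
bb63e4ce29b77f10 §X4–§X6 + `XreadSymmetryInheritGeneric.lean` 2129d5ca1077db8e §Y3), re-scoped into this module by the road owner (l.17756 (f));
STAGED for a prover-role courier (a planner seat cannot file under `Summits/`); no existing file touched.
-/

noncomputable section

namespace Summit.QuantumFields.BalabanUV.Beta.FP.RoadEndShot

open Filter Topology
open Literature.MathematicalPhysics.QuantumFieldTheory.Balaban1983to89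
open Literature.MathematicalPhysics.QuantumFieldTheory.Balaban1983to89.Beta
open Literature.MathematicalPhysics.QuantumFieldTheory.Balaban1983to89.Beta.RateCertificate (GeomRate CauchyRate)
open Literature.MathematicalPhysics.QuantumFieldTheory.Balaban1983to89.Beta.Drift (OneLoopDrift)
open B12Beta (secondMoment)
open B12Normalization (stepBal)
open DressedMomentNormalisation (EKer dressedEntry)
open ExpKernelCalculus (MKer Decays VertexFamily₂ hessKer)
open PolarizationSign (WardTransversal)
open OneStepResolventKernel (Fib LocStencil JetData)
open OneStepKernelFamily (vertexOfK TbalOf flipK D1Drift)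
open Summit.QuantumFields.BalabanUV.Beta.HessKerDressedUnits (unitK unitS unitW)
open Summit.QuantumFields.BalabanUV.Beta.GAN24.CombesThomas (sfStep smStep)
open Summit.QuantumFields.BalabanUV.Beta.FP.PerfectObjectsT (KPerf SPerfOf WPerfOf)
open Summit.QuantumFields.BalabanUV.Beta.FP.TransportInfinityM (colOf)
open Summit.QuantumFields.BalabanUV.Beta.FP.StepDefectInherit (defect)
open Summit.QuantumFields.BalabanUV.Beta.FP.RoadEnd (value_eq_of_step_law_bounded')
open Summit.QuantumFields.BalabanUV.Beta.FP.RoadEndGeneric (KPerfOf TGenOf fPerfG d1Drift_of_generic_step_law_bounded)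
open Summit.QuantumFields.BalabanUV.Beta.FP.StepLawWardGeneric (d1Drift_of_generic_ward_symm_explicitDefect)
open Summit.QuantumFields.BalabanUV.Beta.FP.SymmetryInheritGeneric (d1Drift_of_generic_wardRow_swapRow_explicitDefect)
open Summit.QuantumFields.BalabanUV.Beta.FP.ShotBridge (hasym_of_shot_twoStage)

/-! ## §1 Scalar level: T + two-stage defects + X1m + the step law ⟹ the EXACT value -/

/-- [folklore] **THE PERFECT FAMILY's VALUE IS FORCED.**  ShotBridge §1's conclusion IS the `hasym` binder of `RoadEnd.value_eq_of_step_law_bounded'`: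
with BF-x's level-0 law `hT`, the two-stage telescoping `htel` with `|δ j m| ≤ D`, the X1m convergence `f j m → g m` and the step law
`g (m+1) = g m + g 1` (`1 ≤ m`), the value is `g 1 = s`. -/
theorem value_eq_of_shot_twoStage_step_law {F₀ : ℕ → ℝ} {f δ : ℕ → ℕ → ℝ} {g : ℕ → ℝ} {s C D : ℝ} {L : ℕ}
    (hT : ∀ k : ℕ, |F₀ (L ^ k) - (k : ℝ) * s| ≤ C)
    (htel : ∀ j m : ℕ, F₀ (L ^ (j + m)) = F₀ (L ^ j) + f j m + δ j m)
    (hδ : ∀ j m : ℕ, |δ j m| ≤ D) (hlim : ∀ m : ℕ, Tendsto (fun j => f j m) atTop (𝓝 (g m)))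
    (hstep : ∀ m : ℕ, 1 ≤ m → g (m + 1) = g m + g 1) : g 1 = s :=
  value_eq_of_step_law_bounded' hstep (hasym_of_shot_twoStage hT htel hδ hlim)

/-! ## §2 Kernel level: road FP's three generic ENDs with `hasym := hasym_of_shot_twoStage …` -/

section End

variable {Lc : ℕ} [NeZero Lc] (Js : ℕ → JetData 3 Lc) (sf sm : ℕ → ℝ) (A G : ℕ → ℕ → MKer (3 + 1) (Fib 3))
  (S : ℕ → ℕ → Fin (3 + 1) → (Fin (3 + 1) → ℤ) → MKer (3 + 1) (Fib 3))
  (Wt : ℕ → ℕ → Fin (3 + 1) → (Fin (3 + 1) → ℤ) → Fin (3 + 1) → (Fin (3 + 1) → ℤ) → MKer (3 + 1) (Fib 3))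
  {A1 G1 : ℕ → MKer (3 + 1) (Fib 3)} {S1 : ℕ → Fin (3 + 1) → (Fin (3 + 1) → ℤ) → MKer (3 + 1) (Fib 3)}
  {W1 : ℕ → Fin (3 + 1) → (Fin (3 + 1) → ℤ) → Fin (3 + 1) → (Fin (3 + 1) → ℤ) → MKer (3 + 1) (Fib 3)}
  {R CA cA C cK δK Cs cS δS Cw cW δW θ : ℝ}

/-- **ROAD «FP», THE GENERIC END WITH (ASYMP) := THE BRIDGE** (`d = 3`; bounded-defect form).  `RoadEndGeneric.d1Drift_of_generic_step_law_bounded`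
with its `hasym` argument LITERALLY `hasym_of_shot_twoStage hTlaw htel2 hδ2 hlimX1m` (`Cg := 2·C₀ + D` by unification).  RESIDUAL: {closed form + `m = 1`
names; Cauchy-currency rows (`m = 1`); (STEP) `hstep`; BF-x's level-0 law `hTlaw` at slope `stepBal N Lc`; two-stage telescoping `htel2` with `|δ j m| ≤ D`;
X1m `hlimX1m`} ⊢ `D1Drift Lc Js N μ ν`.  NOT «D1 closed». [our object] -/
theorem d1Drift_of_generic_step_law_shot (hsf : ∀ j, sf j ≠ 0) (hsm : ∀ j, sm j ≠ 0)
    (hT : ∀ j, TbalOf Lc Js j = hessKer (A1 j) (vertexOfK (G1 j) Lc (S1 j)) (W1 j))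
    (hA1 : ∀ j, A j 1 = A1 j) (hG1 : ∀ j, G j 1 = G1 j) (hS1 : ∀ j, S j 1 = S1 j) (hW1 : ∀ j, Wt j 1 = W1 j)
    (hA : ∀ j, Decays (unitK (sf j) (sm j) (A1 j)) CA δK)
    (hAall : ∀ k j, Decays (unitK (sf (k + j)) (sm (k + j)) (A1 (k + j)) - unitK (sf k) (sm k) (A1 k)) (cA * θ ^ k) δK)
    (hK : ∀ j, Decays (unitK (sf j) (sm j) (G1 j)) C δK)
    (hKall : ∀ k j, Decays (unitK (sf (k + j)) (sm (k + j)) (G1 (k + j)) - unitK (sf k) (sm k) (G1 k)) (cK * θ ^ k) δK)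
    (hS : ∀ j, LocStencil (unitS (sf j) (sm j) (S1 j)) Cs δS)
    (hSall : ∀ k j, LocStencil (unitS (sf (k + j)) (sm (k + j)) (S1 (k + j)) - unitS (sf k) (sm k) (S1 k)) (cS * θ ^ k) δS)
    (hW : ∀ j, VertexFamily₂ (unitW (sf j) (sm j) (W1 j)) Lc Cw δW)
    (hWall : ∀ k j, VertexFamily₂ (unitW (sf (k + j)) (sm (k + j)) (W1 (k + j)) - unitW (sf k) (sm k) (W1 k)) Lc (cW * θ ^ k) δW)
    (hR : 0 < R) (hRK : R < δK) (hRS : R / 2 < δS) (hRW : R < δW) (hθ0 : 0 ≤ θ) (hθ1 : θ < 1) (μ ν : Fin 4) {N : ℝ}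
    (hstep : ∀ m : ℕ, 1 ≤ m →
      fPerfG Lc sf sm A G S Wt μ ν (m + 1) = fPerfG Lc sf sm A G S Wt μ ν m + fPerfG Lc sf sm A G S Wt μ ν 1)
    {F₀ : ℕ → ℝ} {f δ : ℕ → ℕ → ℝ} {C₀ D : ℝ}
    (hTlaw : ∀ k : ℕ, |F₀ (Lc ^ k) - (k : ℝ) * stepBal N Lc| ≤ C₀)
    (htel2 : ∀ j m : ℕ, F₀ (Lc ^ (j + m)) = F₀ (Lc ^ j) + f j m + δ j m)
    (hδ2 : ∀ j m : ℕ, |δ j m| ≤ D)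
    (hlimX1m : ∀ m : ℕ, Tendsto (fun j => f j m) atTop (𝓝 (fPerfG Lc sf sm A G S Wt μ ν m))) :
    D1Drift Lc Js N μ ν :=
  d1Drift_of_generic_step_law_bounded Js sf sm A G S Wt hsf hsm hT hA1 hG1 hS1 hW1 hA hAall hK hKall hS hSall hW hWall hR hRK hRS hRW
    hθ0 hθ1 μ ν hstep (hasym_of_shot_twoStage hTlaw htel2 hδ2 hlimX1m)

/-- **ROAD «FP», THE WARD END WITH (ASYMP) := THE BRIDGE** (`d = 3`, `2 ≤ Lc`; bounded-defect form).  `StepLawWardGeneric.d1Drift_of_generic_ward_symm_explicitDefect`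
with `hasym := hasym_of_shot_twoStage hTlaw htel2 hδ2 hlimX1m`.  RESIDUAL: {closed form + `m = 1` names; Cauchy rows (`m = 1`); class data (`m ≥ 1`); **hWf**;
**hTsymm**; **hSDF**; `hTlaw`; `htel2` + `hδ2`; `hlimX1m`} ⊢ `D1Drift Lc Js N μ ν`.  NOT «D1 closed». [our object] -/
theorem d1Drift_of_generic_ward_symm_explicitDefect_shot (hLc2 : 2 ≤ Lc) (hsf : ∀ j, sf j ≠ 0) (hsm : ∀ j, sm j ≠ 0)
    (hT : ∀ j, TbalOf Lc Js j = hessKer (A1 j) (vertexOfK (G1 j) Lc (S1 j)) (W1 j))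
    (hA1 : ∀ j, A j 1 = A1 j) (hG1 : ∀ j, G j 1 = G1 j) (hS1 : ∀ j, S j 1 = S1 j) (hW1 : ∀ j, Wt j 1 = W1 j)
    (hA : ∀ j, Decays (unitK (sf j) (sm j) (A1 j)) CA δK)
    (hAall : ∀ k j, Decays (unitK (sf (k + j)) (sm (k + j)) (A1 (k + j)) - unitK (sf k) (sm k) (A1 k)) (cA * θ ^ k) δK)
    (hK : ∀ j, Decays (unitK (sf j) (sm j) (G1 j)) C δK)
    (hKall : ∀ k j, Decays (unitK (sf (k + j)) (sm (k + j)) (G1 (k + j)) - unitK (sf k) (sm k) (G1 k)) (cK * θ ^ k) δK)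
    (hS : ∀ j, LocStencil (unitS (sf j) (sm j) (S1 j)) Cs δS)
    (hSall : ∀ k j, LocStencil (unitS (sf (k + j)) (sm (k + j)) (S1 (k + j)) - unitS (sf k) (sm k) (S1 k)) (cS * θ ^ k) δS)
    (hW : ∀ j, VertexFamily₂ (unitW (sf j) (sm j) (W1 j)) Lc Cw δW)
    (hWall : ∀ k j, VertexFamily₂ (unitW (sf (k + j)) (sm (k + j)) (W1 (k + j)) - unitW (sf k) (sm k) (W1 k)) Lc (cW * θ ^ k) δW)
    (hR : 0 < R) (hRK : R < δK) (hRS : R / 2 < δS) (hRW : R < δW) (hθ0 : 0 ≤ θ) (hθ1 : θ < 1)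
    (hAinf : ∀ m : ℕ, 1 ≤ m → ∃ δ C : ℝ, 0 < δ ∧ 0 ≤ C ∧ Decays (KPerfOf (d := 3) sf sm A m) C δ)
    (hGinf : ∀ m : ℕ, 1 ≤ m → ∃ δ C : ℝ, 0 < δ ∧ 0 ≤ C ∧ Decays (KPerfOf (d := 3) sf sm G m) C δ)
    (hSinf : ∀ m : ℕ, 1 ≤ m → ∃ Cs δS : ℝ, 0 < δS ∧ LocStencil (SPerfOf sf sm S m) Cs δS)
    (hWinf : ∀ m : ℕ, 1 ≤ m → ∃ Cw δW : ℝ, 0 < δW ∧ VertexFamily₂ (WPerfOf sf sm Wt m) (Lc ^ m) Cw δW)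
    (hWf : WardTransversal (flipK (TGenOf Lc (KPerfOf sf sm A 1) (KPerfOf sf sm G 1) (SPerfOf sf sm S 1) (WPerfOf sf sm Wt 1))))
    (hTsymm : ∀ a b t, TGenOf Lc (KPerfOf sf sm A 1) (KPerfOf sf sm G 1) (SPerfOf sf sm S 1) (WPerfOf sf sm Wt 1) a b t
      = TGenOf Lc (KPerfOf sf sm A 1) (KPerfOf sf sm G 1) (SPerfOf sf sm S 1) (WPerfOf sf sm Wt 1) b a (-t))
    (μ ν : Fin 4)
    (hSDF : ∀ m : ℕ, 1 ≤ m → secondMoment (defect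
      (fun m => TGenOf (Lc ^ m) (KPerfOf sf sm A m) (KPerfOf sf sm G m) (SPerfOf sf sm S m) (WPerfOf sf sm Wt m))
      (fun m a b z => ((Lc ^ m : ℕ) : ℝ) ^ 8 * dressedEntry (colOf (KPerf (d := 3) Lc (sfStep Lc) (smStep 3 Lc) m))
        (TGenOf Lc (KPerfOf sf sm A 1) (KPerfOf sf sm G 1) (SPerfOf sf sm S 1) (WPerfOf sf sm Wt 1))
        (((Lc ^ m : ℕ) : ℤ) • z) a b) m) μ ν = 0)
    {N : ℝ} {F₀ : ℕ → ℝ} {f δ : ℕ → ℕ → ℝ} {C₀ D : ℝ}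
    (hTlaw : ∀ k : ℕ, |F₀ (Lc ^ k) - (k : ℝ) * stepBal N Lc| ≤ C₀)
    (htel2 : ∀ j m : ℕ, F₀ (Lc ^ (j + m)) = F₀ (Lc ^ j) + f j m + δ j m)
    (hδ2 : ∀ j m : ℕ, |δ j m| ≤ D)
    (hlimX1m : ∀ m : ℕ, Tendsto (fun j => f j m) atTop (𝓝 (fPerfG Lc sf sm A G S Wt μ ν m))) :
    D1Drift Lc Js N μ ν :=
  d1Drift_of_generic_ward_symm_explicitDefect Js sf sm A G S Wt hLc2 hsf hsm hT hA1 hG1 hS1 hW1 hA hAall hK hKall hS hSall hW hWall hR hRK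
    hRS hRW hθ0 hθ1 hAinf hGinf hSinf hWinf hWf hTsymm μ ν hSDF (hasym_of_shot_twoStage hTlaw htel2 hδ2 hlimX1m)

/-- **ROAD «FP», THE END FROM THE WALL's SYMMETRY ROWS WITH (ASYMP) := THE BRIDGE** (`d = 3`, `2 ≤ Lc`; bounded-defect form).
`SymmetryInheritGeneric.d1Drift_of_generic_wardRow_swapRow_explicitDefect` with `hasym := hasym_of_shot_twoStage hTlaw htel2 hδ2 hlimX1m`.  RESIDUAL:
{closed form + `m = 1` names; Cauchy rows (`m = 1`); class data (`m ≥ 1`); **hWj**; **hTj**; **hSDF**; `hTlaw`; `htel2` + `hδ2`; `hlimX1m`} ⊢ `D1Drift Lc Js N μ ν`.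
NOT «D1 closed». [our object] -/
theorem d1Drift_of_generic_wardRow_swapRow_shot (hLc2 : 2 ≤ Lc) (hsf : ∀ j, sf j ≠ 0) (hsm : ∀ j, sm j ≠ 0)
    (hT : ∀ j, TbalOf Lc Js j = hessKer (A1 j) (vertexOfK (G1 j) Lc (S1 j)) (W1 j))
    (hA1 : ∀ j, A j 1 = A1 j) (hG1 : ∀ j, G j 1 = G1 j) (hS1 : ∀ j, S j 1 = S1 j) (hW1 : ∀ j, Wt j 1 = W1 j)
    (hA : ∀ j, Decays (unitK (sf j) (sm j) (A1 j)) CA δK)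
    (hAall : ∀ k j, Decays (unitK (sf (k + j)) (sm (k + j)) (A1 (k + j)) - unitK (sf k) (sm k) (A1 k)) (cA * θ ^ k) δK)
    (hK : ∀ j, Decays (unitK (sf j) (sm j) (G1 j)) C δK)
    (hKall : ∀ k j, Decays (unitK (sf (k + j)) (sm (k + j)) (G1 (k + j)) - unitK (sf k) (sm k) (G1 k)) (cK * θ ^ k) δK)
    (hS : ∀ j, LocStencil (unitS (sf j) (sm j) (S1 j)) Cs δS)
    (hSall : ∀ k j, LocStencil (unitS (sf (k + j)) (sm (k + j)) (S1 (k + j)) - unitS (sf k) (sm k) (S1 k)) (cS * θ ^ k) δS)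
    (hW : ∀ j, VertexFamily₂ (unitW (sf j) (sm j) (W1 j)) Lc Cw δW)
    (hWall : ∀ k j, VertexFamily₂ (unitW (sf (k + j)) (sm (k + j)) (W1 (k + j)) - unitW (sf k) (sm k) (W1 k)) Lc (cW * θ ^ k) δW)
    (hR : 0 < R) (hRK : R < δK) (hRS : R / 2 < δS) (hRW : R < δW) (hθ0 : 0 ≤ θ) (hθ1 : θ < 1)
    (hAinf : ∀ m : ℕ, 1 ≤ m → ∃ δ C : ℝ, 0 < δ ∧ 0 ≤ C ∧ Decays (KPerfOf (d := 3) sf sm A m) C δ)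
    (hGinf : ∀ m : ℕ, 1 ≤ m → ∃ δ C : ℝ, 0 < δ ∧ 0 ≤ C ∧ Decays (KPerfOf (d := 3) sf sm G m) C δ)
    (hSinf : ∀ m : ℕ, 1 ≤ m → ∃ Cs δS : ℝ, 0 < δS ∧ LocStencil (SPerfOf sf sm S m) Cs δS)
    (hWinf : ∀ m : ℕ, 1 ≤ m → ∃ Cw δW : ℝ, 0 < δW ∧ VertexFamily₂ (WPerfOf sf sm Wt m) (Lc ^ m) Cw δW)
    (hWj : ∀ j, WardTransversal (flipK (TbalOf Lc Js j)))
    (hTj : ∀ j a b t, TbalOf Lc Js j a b t = TbalOf Lc Js j b a (-t))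
    (μ ν : Fin 4)
    (hSDF : ∀ m : ℕ, 1 ≤ m → secondMoment (defect
      (fun m => TGenOf (Lc ^ m) (KPerfOf sf sm A m) (KPerfOf sf sm G m) (SPerfOf sf sm S m) (WPerfOf sf sm Wt m))
      (fun m a b z => ((Lc ^ m : ℕ) : ℝ) ^ 8 * dressedEntry (colOf (KPerf (d := 3) Lc (sfStep Lc) (smStep 3 Lc) m))
        (TGenOf Lc (KPerfOf sf sm A 1) (KPerfOf sf sm G 1) (SPerfOf sf sm S 1) (WPerfOf sf sm Wt 1))
        (((Lc ^ m : ℕ) : ℤ) • z) a b) m) μ ν = 0)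
    {N : ℝ} {F₀ : ℕ → ℝ} {f δ : ℕ → ℕ → ℝ} {C₀ D : ℝ}
    (hTlaw : ∀ k : ℕ, |F₀ (Lc ^ k) - (k : ℝ) * stepBal N Lc| ≤ C₀)
    (htel2 : ∀ j m : ℕ, F₀ (Lc ^ (j + m)) = F₀ (Lc ^ j) + f j m + δ j m)
    (hδ2 : ∀ j m : ℕ, |δ j m| ≤ D)
    (hlimX1m : ∀ m : ℕ, Tendsto (fun j => f j m) atTop (𝓝 (fPerfG Lc sf sm A G S Wt μ ν m))) :
    D1Drift Lc Js N μ ν :=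
  d1Drift_of_generic_wardRow_swapRow_explicitDefect Js sf sm A G S Wt hLc2 hsf hsm hT hA1 hG1 hS1 hW1 hA hAall hK hKall hS hSall hW hWall
    hR hRK hRS hRW hθ0 hθ1 hAinf hGinf hSinf hWinf hWj hTj μ ν hSDF (hasym_of_shot_twoStage hTlaw htel2 hδ2 hlimX1m)

end End

/-! ## §3 The bridge's T-side meets the rate certificate: T + one-stage defects + X1 (Cauchy currency) ⟹ the limit identified + the geometric clause -/

/-- [folklore] BF-x's level-0 law + ONE-stage telescoping with bounded cumulative defect ⟹ the DRIFT FORM `OneLoopDrift s (C + E) β`. -/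
theorem oneLoopDrift_of_shot_oneStage {F₀ β ε : ℕ → ℝ} {s C E : ℝ} {L : ℕ}
    (hT : ∀ k : ℕ, |F₀ (L ^ k) - (k : ℝ) * s| ≤ C)
    (htel : ∀ k : ℕ, F₀ (L ^ k) = ∑ j ∈ Finset.range k, β j + ε k) (hε : ∀ k : ℕ, |ε k| ≤ E) :
    OneLoopDrift s (C + E) β := by
  intro k
  have h1 := hT k
  rw [htel k] at h1
  have e : ∑ j ∈ Finset.range k, β j - s * (k : ℝ) = (∑ j ∈ Finset.range k, β j + ε k - (k : ℝ) * s) - ε k := by ring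
  rw [e]
  exact (abs_sub _ _).trans (add_le_add h1 (hε k))

/-- [folklore] … + X1 in Cauchy currency (`CauchyRate β c θ`, `θ < 1`; NO value named) ⟹ THE LIMIT IS IDENTIFIED: `CauchyRate.lim β = s`
(`CauchyRate.lim_eq_of_drift`, Cesàro). -/
theorem lim_eq_of_shot_cauchyRate {F₀ β ε : ℕ → ℝ} {s C E c θ : ℝ} {L : ℕ}
    (hT : ∀ k : ℕ, |F₀ (L ^ k) - (k : ℝ) * s| ≤ C)
    (htel : ∀ k : ℕ, F₀ (L ^ k) = ∑ j ∈ Finset.range k, β j + ε k) (hε : ∀ k : ℕ, |ε k| ≤ E)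
    (hX1 : CauchyRate β c θ) (hθ1 : θ < 1) : CauchyRate.lim β = s :=
  hX1.lim_eq_of_drift hθ1 (oneLoopDrift_of_shot_oneStage hT htel hε)

/-- [folklore] … hence the two-ended geometric clause ABOUT `s`: `GeomRate β s (c/(1−θ)) θ` (`CauchyRate.geomRate` + §3's identification). -/
theorem geomRate_of_shot_cauchyRate {F₀ β ε : ℕ → ℝ} {s C E c θ : ℝ} {L : ℕ}
    (hT : ∀ k : ℕ, |F₀ (L ^ k) - (k : ℝ) * s| ≤ C)
    (htel : ∀ k : ℕ, F₀ (L ^ k) = ∑ j ∈ Finset.range k, β j + ε k) (hε : ∀ k : ℕ, |ε k| ≤ E)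
    (hX1 : CauchyRate β c θ) (hθ1 : θ < 1) : GeomRate β s (c / (1 - θ)) θ := by
  have h := hX1.geomRate hθ1
  rwa [lim_eq_of_shot_cauchyRate hT htel hε hX1 hθ1] at h

/-- [folklore] **AT `s := stepBal N Lc`**: the clause `∀ k, |β k − stepBal N Lc| ≤ (c/(1−θ))·θ^k` AND the limit value identified — from {BF-x's T at slope
`stepBal N Lc`, one-stage defects bounded, X1 in Cauchy currency}.  All three are HYPOTHESES; nothing is discharged. -/
theorem laneClause_of_shot_cauchyRate {F₀ β ε : ℕ → ℝ} {N C E c θ : ℝ} {Lc : ℕ}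
    (hT : ∀ k : ℕ, |F₀ (Lc ^ k) - (k : ℝ) * stepBal N Lc| ≤ C)
    (htel : ∀ k : ℕ, F₀ (Lc ^ k) = ∑ j ∈ Finset.range k, β j + ε k) (hε : ∀ k : ℕ, |ε k| ≤ E)
    (hX1 : CauchyRate β c θ) (hθ1 : θ < 1) :
    (∀ k : ℕ, |β k - stepBal N Lc| ≤ c / (1 - θ) * θ ^ k) ∧ CauchyRate.lim β = stepBal N Lc :=
  ⟨geomRate_of_shot_cauchyRate hT htel hε hX1 hθ1, lim_eq_of_shot_cauchyRate hT htel hε hX1 hθ1⟩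

/-- [folklore] … and with certified small-`k` signs `hlist`, ONE certified value `hm` and the gap `hgap`: `∀ k, 0 < β k` (`GeomRate.pos_all`). -/
theorem pos_all_of_shot_cauchyRate_cert {F₀ β ε : ℕ → ℝ} {N C E c θ m : ℝ} {Lc k₁ : ℕ}
    (hT : ∀ k : ℕ, |F₀ (Lc ^ k) - (k : ℝ) * stepBal N Lc| ≤ C)
    (htel : ∀ k : ℕ, F₀ (Lc ^ k) = ∑ j ∈ Finset.range k, β j + ε k) (hε : ∀ k : ℕ, |ε k| ≤ E)
    (hX1 : CauchyRate β c θ) (hθ0 : 0 ≤ θ) (hθ1 : θ < 1)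
    (hlist : ∀ k, k < k₁ → 0 < β k) (hm : m ≤ β k₁) (hgap : 2 * (c / (1 - θ) * θ ^ k₁) < m) : ∀ k, 0 < β k :=
  (geomRate_of_shot_cauchyRate hT htel hε hX1 hθ1).pos_all hθ0 hθ1.le hlist hm hgap

/-- [folklore] … while the positivity OF THE LIMIT needs no certificate: `0 < CauchyRate.lim β` from `0 < N`, `1 < Lc`
(`CauchyRate.lim_pos_of_drift_stepBal`). -/
theorem lim_pos_of_shot_cauchyRate {F₀ β ε : ℕ → ℝ} {N C E c θ : ℝ} {Lc : ℕ}
    (hT : ∀ k : ℕ, |F₀ (Lc ^ k) - (k : ℝ) * stepBal N Lc| ≤ C)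
    (htel : ∀ k : ℕ, F₀ (Lc ^ k) = ∑ j ∈ Finset.range k, β j + ε k) (hε : ∀ k : ℕ, |ε k| ≤ E)
    (hX1 : CauchyRate β c θ) (hθ1 : θ < 1) (hN : 0 < N) (hLc : 1 < (Lc : ℝ)) : 0 < CauchyRate.lim β :=
  hX1.lim_pos_of_drift_stepBal hθ1 (oneLoopDrift_of_shot_oneStage hT htel hε) hN hLc

end Summit.QuantumFields.BalabanUV.Beta.FP.RoadEndShot

end
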